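import Summits.QuantumFields.YangMills.Theorems.AllWindowsColdBoxBoxHighLineGhostFPGen
import Summits.QuantumFields.YangMills.Theorems.AllWindowsColdBoxBoxHighLineFPOperatorInverseRows
import Summits.QuantumFields.YangMills.Theorems.AllWindowsColdBoxBoxHighLineSmearedFPOperatorFloor
import Summits.QuantumFields.YangMills.Theorems.AllWindowsColdBoxBoxHighLineOrbitMapContractionPrelims
import Summits.QuantumFields.YangMills.Theorems.AllWindowsColdBoxBoxHighLineSmearedFPOperatorExpansion

/-!
# T-S5.7d input: the ghost propagator against a local link field — entry, trace, Hilbert–Schmidt and operator bounds of `F₁⁻¹·fpGen W`,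
# and the edge-chart link split `↑(expPauli v) = 1 + X(v) − (‖v‖²/2)·1 + O(‖v‖³)`
# (STUB-PLAN-S5-STEP2 §8, planner ym-idea-2 g18 routing 2026-08-29T19:46:09Z (iii) `GhostTaylor`; LINE-19 S5 ⟨stmt-QuantumFields-24004⟩/⟨24335⟩)

Width seat `ym-line-sfw-p2-w3` (g40).  With `F₁⁻¹ = −(G ⊗ₖ pauliPerm)` (✓`fpOperator_one_inv`, `G = (dirichletMatrix (interiorSites H))⁻¹ ≥ 0`) and the
entry bound ✓`GhostFP.abs_fpGen_le` (`|fpGen W (z,d)(x,c)| ≤ 3δ·nbW z x`):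
* `GhostFP.ghostX H W := (fpOperator H 1)⁻¹ * fpGen H W` and `|ghostX W (y,b)(x,c)| ≤ 3δ · Σ_z G(y,z)·nbW z x` (`abs_ghostX_le`);
* TRACE `|tr ghostX W| ≤ 144·C_G·δ·|I|` given `G ≤ C_G` (`abs_trace_ghostX_le`);
* HILBERT–SCHMIDT `Σ (ghostX W)_{pq}² ≤ 20736·δ²·|I|·C_r` given the column bound `Σ_y G(y,z)² ≤ C_r` (`sum_sq_ghostX_le`);
* OPERATOR bound of the true perturbation: `‖F₁⁻¹(F(U) − F₁)v‖² ≤ (336 H² δ)²‖v‖²` when `‖↑U_e − 1‖ ≤ δ` on the box links (`ghost_opBound`);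
* the edge-chart link split `↑(expPauli v) − 1 = X(v) + (−‖v‖²/2)·1 + R(v)` with `‖X(v)‖ ≤ 3‖v‖`, `‖(−‖v‖²/2)·1‖ ≤ ‖v‖²/2`,
  `‖R(v)‖ ≤ ‖v‖³` and `‖↑(expPauli v) − 1‖ ≤ 4‖v‖` for `‖v‖ ≤ 1` (`norm_chartRem_le`, from `Real.cos_bound`, ✓`abs_sinc_sub_one_le`).

Everything proved; one bookkeeping definition (`ghostX`); standard axioms.  HONEST LABEL: an input of ONE brick (7d) of STEP 2 of the XL stub S5 of a
critic-PASSed DRAFT line; 7d, S5, U5, ⟨24004⟩ ⟨24335⟩ ⟨24336⟩ remain OPEN; no crux, rung or summit is proved; **the Yang–Mills mass gap is NOT proved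
by this file.**
-/

set_option autoImplicit false

noncomputable section

open Matrix Finset
open scoped Matrix.Norms.Operator Kronecker
open Literature.MathematicalPhysics.QuantumFieldTheory.Balaban1983to89.B10Eq18SigmaSU2 (su2Coord)
open Literature.MathematicalPhysics.QuantumFieldTheory.Balaban1983to89.B10Eq18SigmaSU2Haar (expPauli)
open Literature.MathematicalPhysics.QuantumFieldTheory.AxialGauge (boxEdges)
open Literature.MathematicalPhysics.QuantumLattice (LGConfig ZdEdge)
open Literature.Probability.LatticeModels (Site dirichletMatrix)

namespace Summit.QuantumFields.YangMills.Theorems.AllWindowsColdBoxBoxHighLine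

namespace GhostFP

open OrbitMapSurj (fpOperator_one_inv)
open SpectralFloor (fpOperator_one_inv_opBound)

variable {H : ℕ}

/-! ## The edge-chart link split -/

/-- The cubic remainder of the chart link: `↑(expPauli v) − 1 − X(v) + (‖v‖²/2)·1`. -/
theorem coe_expPauli_sub_eq (v : E3) :
    ((expPauli v : SU2) : Matrix (Fin 2) (Fin 2) ℂ) - 1 =
      su2Coord (WithLp.ofLp v) + (-(‖v‖ ^ 2 / 2) : ℝ) • (1 : Matrix (Fin 2) (Fin 2) ℂ) +
        (((Real.cos ‖v‖ - 1 + ‖v‖ ^ 2 / 2 : ℝ) : ℂ) • (1 : Matrix (Fin 2) (Fin 2) ℂ) +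
          ((Real.sinc ‖v‖ - 1 : ℝ) : ℂ) • su2Coord (WithLp.ofLp v)) := by
  rw [coe_expPauli_eq]
  have h1 : ((-(‖v‖ ^ 2 / 2) : ℝ)) • (1 : Matrix (Fin 2) (Fin 2) ℂ) = (((-(‖v‖ ^ 2 / 2) : ℝ)) : ℂ) • (1 : Matrix (Fin 2) (Fin 2) ℂ) := by
    ext i j; simp
  rw [h1]
  simp only [Complex.ofReal_sub, Complex.ofReal_add, Complex.ofReal_neg, Complex.ofReal_one, sub_smul, add_smul, neg_smul, one_smul]
  abel

/-- **Size of the cubic remainder**: `‖(cos‖v‖ − 1 + ‖v‖²/2)·1 + (sinc‖v‖ − 1)·X(v)‖ ≤ ‖v‖³` for `‖v‖ ≤ 1`. -/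
theorem norm_chartRem_le (v : E3) (hv : ‖v‖ ≤ 1) :
    Norm.norm ((((Real.cos ‖v‖ - 1 + ‖v‖ ^ 2 / 2 : ℝ) : ℂ) • (1 : Matrix (Fin 2) (Fin 2) ℂ) +
        ((Real.sinc ‖v‖ - 1 : ℝ) : ℂ) • su2Coord (WithLp.ofLp v)) : Matrix (Fin 2) (Fin 2) ℂ) ≤ ‖v‖ ^ 3 := by
  have h0 : 0 ≤ ‖v‖ := norm_nonneg v
  have hcos : |Real.cos ‖v‖ - 1 + ‖v‖ ^ 2 / 2| ≤ ‖v‖ ^ 4 * (5 / 96) := by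
    have h := Real.cos_bound (show |‖v‖| ≤ 1 by rw [abs_of_nonneg h0]; exact hv)
    rw [abs_of_nonneg h0] at h
    have e : Real.cos ‖v‖ - 1 + ‖v‖ ^ 2 / 2 = Real.cos ‖v‖ - (1 - ‖v‖ ^ 2 / 2) := by ring
    rw [e]; exact h
  have hsinc : |Real.sinc ‖v‖ - 1| ≤ ‖v‖ ^ 2 / 6 := abs_sinc_sub_one_le h0
  calc _ ≤ ‖((Real.cos ‖v‖ - 1 + ‖v‖ ^ 2 / 2 : ℝ) : ℂ) • (1 : Matrix (Fin 2) (Fin 2) ℂ)‖ + ‖((Real.sinc ‖v‖ - 1 : ℝ) : ℂ) • su2Coord (WithLp.ofLp v)‖ :=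
        norm_add_le _ _
    _ ≤ ‖v‖ ^ 4 * (5 / 96) * 1 + ‖v‖ ^ 2 / 6 * (3 * ‖v‖) := by
        rw [norm_smul, norm_smul, Complex.norm_real, Complex.norm_real, Real.norm_eq_abs, Real.norm_eq_abs, norm_one]
        exact add_le_add (mul_le_mul hcos le_rfl zero_le_one (by positivity))
          (mul_le_mul hsinc (Parity.norm_su2Coord_le v) (norm_nonneg _) (by positivity))
    _ ≤ ‖v‖ ^ 3 := by nlinarith [pow_le_pow_of_le_one h0 hv (show 3 ≤ 4 by norm_num), pow_nonneg h0 3]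

/-- `‖X(v)‖ ≤ 3‖v‖` (re-export for the chart field). -/
theorem norm_su2Coord_chart_le (v : E3) : ‖su2Coord (WithLp.ofLp v)‖ ≤ 3 * ‖v‖ := Parity.norm_su2Coord_le v

/-- `‖(−‖v‖²/2)·1‖ ≤ ‖v‖²/2`. -/
theorem norm_quadScalar_le (v : E3) : ‖((-(‖v‖ ^ 2 / 2) : ℝ)) • (1 : Matrix (Fin 2) (Fin 2) ℂ)‖ ≤ ‖v‖ ^ 2 / 2 := by
  rw [norm_smul, norm_one, mul_one, Real.norm_eq_abs, abs_neg, abs_of_nonneg (by positivity)]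

/-! ## The ghost propagator against a local link field -/

/-- `X_W := F₁⁻¹ · fpGen W`. -/
def ghostX (H : ℕ) (W : ZdEdge 4 → Matrix (Fin 2) (Fin 2) ℂ) : Matrix (↥(interiorSites H) × Fin 3) (↥(interiorSites H) × Fin 3) ℝ :=
  (fpOperator H 1)⁻¹ * fpGen H W

/-- `ghostX` is additive. -/
theorem ghostX_add (W W' : ZdEdge 4 → Matrix (Fin 2) (Fin 2) ℂ) : ghostX H (W + W') = ghostX H W + ghostX H W' := by
  rw [ghostX, ghostX, ghostX, fpGen_add, Matrix.mul_add]

/-- `ghostX` is ℝ-homogeneous. -/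
theorem ghostX_smul (r : ℝ) (W : ZdEdge 4 → Matrix (Fin 2) (Fin 2) ℂ) : ghostX H (r • W) = r • ghostX H W := by
  rw [ghostX, ghostX, fpGen_smul, Matrix.mul_smul]

/-- `ghostX` over finite sums. -/
theorem ghostX_sum {ι : Type*} (s : Finset ι) (W : ι → ZdEdge 4 → Matrix (Fin 2) (Fin 2) ℂ) :
    ghostX H (∑ i ∈ s, W i) = ∑ i ∈ s, ghostX H (W i) := by
  rw [ghostX, fpGen_sum, Matrix.mul_sum]
  rfl

/-- Each row of `pauliPerm` has absolute row sum `1`. -/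
theorem pauliPerm_row_abs (b : Fin 3) : ∑ d, |pauliPerm b d| = 1 := by
  fin_cases b <;> simp [pauliPerm, Fin.sum_univ_three]

/-- **Entry bound through the ghost propagator**: `|X_W (y,b)(x,c)| ≤ 3δ · Σ_z G(y,z) nbW z x` (`G ≥ 0`, `‖W_e‖ ≤ δ` on the box). -/
theorem abs_ghostX_le (hG0 : ∀ x z : ↥(interiorSites H), 0 ≤ (dirichletMatrix (interiorSites H))⁻¹ x z)
    (W : ZdEdge 4 → Matrix (Fin 2) (Fin 2) ℂ) {δ : ℝ} (hW : ∀ e ∈ boxEdges 4 (2 * H + 1), ‖W e‖ ≤ δ)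
    (p q : ↥(interiorSites H) × Fin 3) :
    |ghostX H W p q| ≤ 3 * δ * ∑ z : ↥(interiorSites H), (dirichletMatrix (interiorSites H))⁻¹ p.1 z * nbW (z : Site 4) (q.1 : Site 4) := by
  rw [ghostX, Matrix.mul_apply, fpOperator_one_inv]
  calc |∑ r, (-((dirichletMatrix (interiorSites H))⁻¹ ⊗ₖ pauliPerm)) p r * fpGen H W r q|
      ≤ ∑ r, |(-((dirichletMatrix (interiorSites H))⁻¹ ⊗ₖ pauliPerm)) p r * fpGen H W r q| := Finset.abs_sum_le_sum_abs _ _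
    _ ≤ ∑ r : ↥(interiorSites H) × Fin 3, (dirichletMatrix (interiorSites H))⁻¹ p.1 r.1 * |pauliPerm p.2 r.2| *
          (3 * δ * nbW (r.1 : Site 4) (q.1 : Site 4)) := Finset.sum_le_sum fun r _ => by
        rw [abs_mul, Matrix.neg_apply, abs_neg, Matrix.kroneckerMap_apply, abs_mul, abs_of_nonneg (hG0 _ _)]
        exact mul_le_mul_of_nonneg_left (abs_fpGen_le W hW r q) (mul_nonneg (hG0 _ _) (abs_nonneg _))
    _ = 3 * δ * ∑ z : ↥(interiorSites H), (dirichletMatrix (interiorSites H))⁻¹ p.1 z * nbW (z : Site 4) (q.1 : Site 4) := by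
        rw [Fintype.sum_prod_type, Finset.mul_sum]
        refine Finset.sum_congr rfl fun z _ => ?_
        have : ∑ d : Fin 3, (dirichletMatrix (interiorSites H))⁻¹ p.1 z * |pauliPerm p.2 d| * (3 * δ * nbW (z : Site 4) (q.1 : Site 4)) =
            (dirichletMatrix (interiorSites H))⁻¹ p.1 z * (3 * δ * nbW (z : Site 4) (q.1 : Site 4)) * ∑ d : Fin 3, |pauliPerm p.2 d| := by
          rw [Finset.mul_sum]; exact Finset.sum_congr rfl fun d _ => by ring
        rw [this, pauliPerm_row_abs, mul_one]; ring

/-- **Trace bound**: `|tr X_W| ≤ 144 · C_G · δ · |I|` when `0 ≤ G ≤ C_G` (`0 ≤ δ`, `0 ≤ C_G`). -/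
theorem abs_trace_ghostX_le (hG0 : ∀ x z : ↥(interiorSites H), 0 ≤ (dirichletMatrix (interiorSites H))⁻¹ x z) {CG : ℝ} (hCG : 0 ≤ CG)
    (hGC : ∀ x z : ↥(interiorSites H), (dirichletMatrix (interiorSites H))⁻¹ x z ≤ CG)
    (W : ZdEdge 4 → Matrix (Fin 2) (Fin 2) ℂ) {δ : ℝ} (hδ : 0 ≤ δ) (hW : ∀ e ∈ boxEdges 4 (2 * H + 1), ‖W e‖ ≤ δ) :
    |(ghostX H W).trace| ≤ 144 * CG * δ * Fintype.card ↥(interiorSites H) := by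
  rw [Matrix.trace]
  calc |∑ p, Matrix.diag (ghostX H W) p| ≤ ∑ p, |ghostX H W p p| := Finset.abs_sum_le_sum_abs _ _
    _ ≤ ∑ p : ↥(interiorSites H) × Fin 3, 3 * δ * ∑ z : ↥(interiorSites H),
          (dirichletMatrix (interiorSites H))⁻¹ p.1 z * nbW (z : Site 4) (p.1 : Site 4) :=
        Finset.sum_le_sum fun p _ => abs_ghostX_le hG0 W hW p p
    _ ≤ ∑ p : ↥(interiorSites H) × Fin 3, 3 * δ * ∑ z : ↥(interiorSites H), CG * nbW (z : Site 4) (p.1 : Site 4) := by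
        gcongr with p _ z _
        · exact nbW_nonneg _ _
        · exact hGC _ _
    _ ≤ ∑ _p : ↥(interiorSites H) × Fin 3, 3 * δ * (CG * 16) := by
        refine Finset.sum_le_sum fun p _ => mul_le_mul_of_nonneg_left ?_ (by positivity)
        rw [← Finset.mul_sum]
        exact mul_le_mul_of_nonneg_left (sum_nbW_left_le (p.1 : Site 4)) hCG
    _ = 144 * CG * δ * Fintype.card ↥(interiorSites H) := by
        rw [Finset.sum_const, Finset.card_univ, Fintype.card_prod, Fintype.card_fin, nsmul_eq_mul]; push_cast; ring

/-- Weighted Cauchy–Schwarz: `(Σ w_z G_z)² ≤ (Σ w_z)·(Σ w_z G_z²)` for `w ≥ 0`. -/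
theorem sq_sum_mul_le {κ : Type*} [Fintype κ] (w G : κ → ℝ) (hw : ∀ z, 0 ≤ w z) :
    (∑ z, G z * w z) ^ 2 ≤ (∑ z, w z) * ∑ z, G z ^ 2 * w z := by
  have h := Finset.sum_mul_sq_le_sq_mul_sq Finset.univ (fun z => Real.sqrt (w z)) (fun z => Real.sqrt (w z) * G z)
  have e1 : ∀ z, Real.sqrt (w z) * (Real.sqrt (w z) * G z) = G z * w z := fun z => by
    rw [← mul_assoc, Real.mul_self_sqrt (hw z)]; ring
  have e2 : ∀ z, Real.sqrt (w z) ^ 2 = w z := fun z => Real.sq_sqrt (hw z)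
  have e3 : ∀ z, (Real.sqrt (w z) * G z) ^ 2 = G z ^ 2 * w z := fun z => by rw [mul_pow, Real.sq_sqrt (hw z)]; ring
  simp only [e1, e2, e3] at h
  exact h

/-- **Hilbert–Schmidt bound**: `Σ_{p,q} (X_W)_{pq}² ≤ 20736 · δ² · |I| · C_r` when `G ≥ 0` and the columns obey `Σ_y G(y,z)² ≤ C_r`. -/
theorem sum_sq_ghostX_le (hG0 : ∀ x z : ↥(interiorSites H), 0 ≤ (dirichletMatrix (interiorSites H))⁻¹ x z) {Cr : ℝ}
    (hcol : ∀ z : ↥(interiorSites H), ∑ y, ((dirichletMatrix (interiorSites H))⁻¹ y z) ^ 2 ≤ Cr)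
    (W : ZdEdge 4 → Matrix (Fin 2) (Fin 2) ℂ) {δ : ℝ} (hW : ∀ e ∈ boxEdges 4 (2 * H + 1), ‖W e‖ ≤ δ) :
    ∑ p, ∑ q, (ghostX H W p q) ^ 2 ≤ 20736 * δ ^ 2 * Fintype.card ↥(interiorSites H) * Cr := by
  set G := (dirichletMatrix (interiorSites H))⁻¹ with hG
  -- per entry
  have hent : ∀ p q : ↥(interiorSites H) × Fin 3, (ghostX H W p q) ^ 2 ≤
      9 * δ ^ 2 * (16 * ∑ z : ↥(interiorSites H), G p.1 z ^ 2 * nbW (z : Site 4) (q.1 : Site 4)) := by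
    intro p q
    have h1 := abs_ghostX_le hG0 W hW p q
    have h2 : (ghostX H W p q) ^ 2 ≤ (3 * δ * ∑ z : ↥(interiorSites H), G p.1 z * nbW (z : Site 4) (q.1 : Site 4)) ^ 2 := by
      rw [← sq_abs]; exact pow_le_pow_left₀ (abs_nonneg _) h1 2
    have h3 := sq_sum_mul_le (fun z : ↥(interiorSites H) => nbW (z : Site 4) (q.1 : Site 4)) (fun z => G p.1 z)
      (fun z => nbW_nonneg _ _)
    have h4 : (∑ z : ↥(interiorSites H), nbW (z : Site 4) (q.1 : Site 4)) ≤ 16 := sum_nbW_left_le _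
    have h5 : 0 ≤ ∑ z : ↥(interiorSites H), G p.1 z ^ 2 * nbW (z : Site 4) (q.1 : Site 4) :=
      Finset.sum_nonneg fun z _ => mul_nonneg (sq_nonneg _) (nbW_nonneg _ _)
    calc (ghostX H W p q) ^ 2 ≤ (3 * δ * ∑ z : ↥(interiorSites H), G p.1 z * nbW (z : Site 4) (q.1 : Site 4)) ^ 2 := h2
      _ = 9 * δ ^ 2 * (∑ z : ↥(interiorSites H), G p.1 z * nbW (z : Site 4) (q.1 : Site 4)) ^ 2 := by ring
      _ ≤ 9 * δ ^ 2 * ((∑ z : ↥(interiorSites H), nbW (z : Site 4) (q.1 : Site 4)) *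
            ∑ z : ↥(interiorSites H), G p.1 z ^ 2 * nbW (z : Site 4) (q.1 : Site 4)) := by gcongr
      _ ≤ 9 * δ ^ 2 * (16 * ∑ z : ↥(interiorSites H), G p.1 z ^ 2 * nbW (z : Site 4) (q.1 : Site 4)) := by gcongr
  -- sum over `p = (y,b)`, `q = (x,c)`
  have hxz : ∀ y : ↥(interiorSites H), ∑ x : ↥(interiorSites H), ∑ z : ↥(interiorSites H), G y z ^ 2 * nbW (z : Site 4) (x : Site 4) ≤
      16 * ∑ z : ↥(interiorSites H), G y z ^ 2 := by
    intro y
    rw [Finset.sum_comm, Finset.mul_sum]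
    refine Finset.sum_le_sum fun z _ => ?_
    rw [← Finset.mul_sum]
    calc G y z ^ 2 * ∑ x : ↥(interiorSites H), nbW (z : Site 4) (x : Site 4) ≤ G y z ^ 2 * 16 :=
          mul_le_mul_of_nonneg_left (sum_nbW_right_le _) (sq_nonneg _)
      _ = 16 * G y z ^ 2 := by ring
  have hyz : ∑ y : ↥(interiorSites H), ∑ z : ↥(interiorSites H), G y z ^ 2 ≤ Fintype.card ↥(interiorSites H) * Cr := by
    rw [Finset.sum_comm]
    calc ∑ z : ↥(interiorSites H), ∑ y : ↥(interiorSites H), G y z ^ 2 ≤ ∑ _z : ↥(interiorSites H), Cr :=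
          Finset.sum_le_sum fun z _ => hcol z
      _ = Fintype.card ↥(interiorSites H) * Cr := by rw [Finset.sum_const, Finset.card_univ, nsmul_eq_mul]
  have hconst : ∀ (f : ↥(interiorSites H) → ℝ), ∑ p : ↥(interiorSites H) × Fin 3, f p.1 = 3 * ∑ y : ↥(interiorSites H), f y := by
    intro f
    rw [Fintype.sum_prod_type, Finset.mul_sum]
    refine Finset.sum_congr rfl fun y _ => ?_
    simp only [Finset.sum_const, Finset.card_univ, Fintype.card_fin, nsmul_eq_mul]
    push_cast; ring
  calc ∑ p, ∑ q, (ghostX H W p q) ^ 2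
      ≤ ∑ p : ↥(interiorSites H) × Fin 3, ∑ q : ↥(interiorSites H) × Fin 3,
          9 * δ ^ 2 * (16 * ∑ z : ↥(interiorSites H), G p.1 z ^ 2 * nbW (z : Site 4) (q.1 : Site 4)) :=
        Finset.sum_le_sum fun p _ => Finset.sum_le_sum fun q _ => hent p q
    _ = 144 * δ ^ 2 * (3 * ∑ y : ↥(interiorSites H), (3 * ∑ x : ↥(interiorSites H),
          ∑ z : ↥(interiorSites H), G y z ^ 2 * nbW (z : Site 4) (x : Site 4))) := by
        rw [← hconst (fun y => 3 * ∑ x : ↥(interiorSites H), ∑ z : ↥(interiorSites H), G y z ^ 2 * nbW (z : Site 4) (x : Site 4)),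
          Finset.mul_sum]
        refine Finset.sum_congr rfl fun p _ => ?_
        rw [← hconst (fun x => ∑ z : ↥(interiorSites H), G p.1 z ^ 2 * nbW (z : Site 4) (x : Site 4))]
        rw [Finset.mul_sum (s := (Finset.univ : Finset (↥(interiorSites H) × Fin 3)))]
        refine Finset.sum_congr rfl fun q _ => ?_
        ring
    _ ≤ 144 * δ ^ 2 * (3 * ∑ y : ↥(interiorSites H), (3 * (16 * ∑ z : ↥(interiorSites H), G y z ^ 2))) := by
        gcongr with y _
        exact hxz y
    _ = 20736 * δ ^ 2 * ∑ y : ↥(interiorSites H), ∑ z : ↥(interiorSites H), G y z ^ 2 := by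
        rw [← Finset.mul_sum, ← Finset.mul_sum]
        ring
    _ ≤ 20736 * δ ^ 2 * (Fintype.card ↥(interiorSites H) * Cr) := by gcongr
    _ = 20736 * δ ^ 2 * Fintype.card ↥(interiorSites H) * Cr := by ring

/-- **Operator bound of the true ghost perturbation**: `‖F₁⁻¹(F(U) − F₁) v‖² ≤ (336 H² δ)² ‖v‖²` when `‖↑U_e − 1‖ ≤ δ` on the box links. -/
theorem ghost_opBound (hH : 1 ≤ H) (U : LGConfig 4 SU2) {δ : ℝ}
    (hU : ∀ e ∈ boxEdges 4 (2 * H + 1), ‖(U e : Matrix (Fin 2) (Fin 2) ℂ) - 1‖ ≤ δ) (v : ↥(interiorSites H) × Fin 3 → ℝ) :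
    (((fpOperator H 1)⁻¹ * (fpOperator H U - fpOperator H 1)) *ᵥ v) ⬝ᵥ (((fpOperator H 1)⁻¹ * (fpOperator H U - fpOperator H 1)) *ᵥ v) ≤
      (336 * (H : ℝ) ^ 2 * δ) ^ 2 * (v ⬝ᵥ v) := by
  rw [← Matrix.mulVec_mulVec]
  have h1 := fpOperator_one_inv_opBound hH ((fpOperator H U - fpOperator H 1) *ᵥ v)
  have h2 := fpOperator_sub_one_opBound U hU v
  have hH4 : 0 ≤ 16 * (H : ℝ) ^ 4 := by positivity
  calc _ ≤ 16 * (H : ℝ) ^ 4 * (((fpOperator H U - fpOperator H 1) *ᵥ v) ⬝ᵥ ((fpOperator H U - fpOperator H 1) *ᵥ v)) := h1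
    _ ≤ 16 * (H : ℝ) ^ 4 * ((84 * δ) ^ 2 * (v ⬝ᵥ v)) := mul_le_mul_of_nonneg_left h2 hH4
    _ = (336 * (H : ℝ) ^ 2 * δ) ^ 2 * (v ⬝ᵥ v) := by ring

end GhostFP

end Summit.QuantumFields.YangMills.Theorems.AllWindowsColdBoxBoxHighLine

end
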